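import Mathlib.Analysis.Calculus.BumpFunction.SmoothApprox
import Mathlib.Topology.MetricSpace.HausdorffDimension
import Mathlib.AlgebraicTopology.FundamentalGroupoid.SimplyConnected
import Mathlib.Topology.UrysohnsLemma
import Mathlib.Topology.OpenPartialHomeomorph.Basic
import Mathlib.Topology.UniformSpace.HeineCantor
import HarnessLib

/-!
# Removing a point with a Euclidean neighbourhood of dimension `≥ 3` preserves simple connectivity

Let `M` be a Hausdorff space and `i : E → M` an open embedding of a finite-dimensional real normed
space (a "Euclidean neighbourhood" of the point `p = i 0`). We prove the general position facts

* `Literature.AlgebraicTopology.FundamentalGroupoid.exists_continuousMap_eqOn_forall_ne`: a continuous map `f : K → M` from a compact space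
  which is a uniform retract of a real normed space `W` with `dim W < dim E` (e.g. `K = [0,1]²`,
  `W = ℝ²`) can be pushed off `p`, without changing it on any closed set `Z` with `p ∉ f '' Z`;
* `Literature.AlgebraicTopology.FundamentalGroupoid.isPathConnected_compl_singleton_of_isOpenEmbedding`: `M ∖ {p}` is path connected if `M`
  is and `2 ≤ dim E`;
* `Literature.AlgebraicTopology.FundamentalGroupoid.isSimplyConnected_compl_singleton_of_isOpenEmbedding`: `M ∖ {p}` is simply connected if
  `M` is and `3 ≤ dim E` (the injectivity of `π₁(M ∖ p) → π₁(M)`, i.e. the special case of the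
  Seifert–van Kampen theorem / general position used for connected sums; Kosinski, *Differential
  Manifolds* (1993), VI.2; Hatcher, *Algebraic Topology* (2002), proof of Prop. 1.14).

Proof of the first fact (general position by smoothing, cf. Hirsch, *Differential Topology*, Ch. 3,
Thm 2.5, and Hatcher, proof of Prop. 1.14): near `f ⁻¹ (i (closed ball))` write `f = i ∘ h`;
approximate `h` uniformly by a smooth map `g₁` defined on `W`
(`UniformContinuous.exists_contDiff_dist_le`); since `dim W < dim E` the range of `g₁` has dense
complement (`ContDiff.dense_compl_range_of_finrank_lt_finrank`, a special case of Sard's theorem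
via Hausdorff dimension), so some small vector `v` is not a value of `g₁`; then
`i (h + φ • (g₁ - v - h))`, with `φ` an Urysohn cut-off equal to `1` near `f ⁻¹ p` and `0` away
from it, misses `p` and agrees with `f` away from `f ⁻¹ p`.
-/

noncomputable section

open Set Metric Topology unitInterval Function Module Filter

namespace Literature.AlgebraicTopology.FundamentalGroupoid

section Perturb

variable {E : Type*} [NormedAddCommGroup E] [NormedSpace ℝ E] [FiniteDimensional ℝ E]
  {W : Type*} [NormedAddCommGroup W] [NormedSpace ℝ W] [FiniteDimensional ℝ W]
  {K : Type*} [UniformSpace K] [CompactSpace K]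
  {M : Type*} [TopologicalSpace M] [T2Space M]

/-- **General position off a point.** Let `i : E → M` be an open embedding of a
finite-dimensional real normed space into a Hausdorff space, `K` a compact uniform space
which is a uniform retract of a finite-dimensional real normed space `W` (`π ∘ ι = id`, `ι`
continuous, `π` uniformly continuous) with `dim W < dim E`, and `f : K → M` continuous. If `Z ⊆ K`
is closed and `f '' Z` avoids `p = i 0`, there is a continuous `g : K → M` avoiding `p` everywhere
and equal to `f` on `Z` (smoothing + Sard-type dimension count; Hirsch, *Differential Topology*
(1976), Ch. 3, Thm 2.5; Hatcher, *Algebraic Topology* (2002), proof of Prop. 1.14). [folklore] -/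
theorem exists_continuousMap_eqOn_forall_ne {ι : K → W} {π : W → K} (hι : Continuous ι)
    (hπ : UniformContinuous π) (hπι : ∀ x, π (ι x) = x) (hWE : finrank ℝ W < finrank ℝ E)
    {i : E → M} (hi : IsOpenEmbedding i) (f : C(K, M)) {Z : Set K} (hZ : IsClosed Z)
    (hfZ : ∀ z ∈ Z, f z ≠ i 0) :
    ∃ g : C(K, M), EqOn g f Z ∧ ∀ x, g x ≠ i 0 := by
  classical
  -- Step 0: a closed ball around `0` whose image misses `f '' Z`.
  obtain ⟨ρ, hρ, hρZ⟩ : ∃ ρ > (0 : ℝ), ∀ v : E, ‖v‖ ≤ 4 * ρ → i v ∉ f '' Z := by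
    have hc : IsClosed (f '' Z) := (hZ.isCompact.image f.continuous).isClosed
    have h0 : i ⁻¹' (f '' Z)ᶜ ∈ 𝓝 (0 : E) := by
      refine (hc.isOpen_compl.preimage hi.continuous).mem_nhds ?_
      rintro ⟨z, hz, hz'⟩
      exact hfZ z hz hz'
    obtain ⟨ε, hε, hball⟩ := Metric.mem_nhds_iff.1 h0
    refine ⟨ε / 8, by positivity, fun v hv hv' => ?_⟩
    have : v ∈ ball (0 : E) ε := by rw [mem_ball_zero_iff]; linarith
    exact hball this hv'
  -- Notation: the partial inverse of `i`, and the tubes `A r ⊆ O r'` around `f ⁻¹ p`.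
  set e := hi.toOpenPartialHomeomorph i with he_def
  set h : K → E := fun x => e.symm (f x) with hh_def
  set S : Set K := f ⁻¹' range i with hS_def
  set A : ℝ → Set K := fun r => f ⁻¹' (i '' closedBall 0 r) with hA_def
  set O : ℝ → Set K := fun r => f ⁻¹' (i '' ball 0 r) with hO_def
  have hSo : IsOpen S := hi.isOpen_range.preimage f.continuous
  have hAc : ∀ r, IsClosed (A r) := fun r =>
    ((isCompact_closedBall (0 : E) r).image hi.continuous).isClosed.preimage f.continuous
  have hOo : ∀ r, IsOpen (O r) := fun r => (hi.isOpenMap _ isOpen_ball).preimage f.continuous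
  have hOA : ∀ r, O r ⊆ A r := fun r => preimage_mono (image_mono ball_subset_closedBall)
  have hAO : ∀ r r', r < r' → A r ⊆ O r' := fun r r' hrr' =>
    preimage_mono (image_mono (closedBall_subset_ball hrr'))
  have hOO : ∀ r r', r ≤ r' → O r ⊆ O r' := fun r r' hrr' =>
    preimage_mono (image_mono (ball_subset_ball hrr'))
  have hAS : ∀ r, A r ⊆ S := fun r => preimage_mono (image_subset_range _ _)
  have hih : ∀ x ∈ S, i (h x) = f x := fun x hx => hi.toOpenPartialHomeomorph_right_inv i hx
  have hhi : ∀ v, e.symm (i v) = v := fun v => hi.toOpenPartialHomeomorph_left_inv i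
  have hA_iff : ∀ r x, x ∈ A r ↔ x ∈ S ∧ ‖h x‖ ≤ r := by
    intro r x
    constructor
    · rintro ⟨v, hv, hvx⟩
      refine ⟨⟨v, hvx⟩, ?_⟩
      have : h x = v := by simp only [hh_def, ← hvx, hhi]
      rw [this]
      exact mem_closedBall_zero_iff.1 hv
    · rintro ⟨hxS, hxr⟩
      exact ⟨h x, mem_closedBall_zero_iff.2 hxr, hih x hxS⟩
  have hO_iff : ∀ r x, x ∈ O r ↔ x ∈ S ∧ ‖h x‖ < r := by
    intro r x
    constructor
    · rintro ⟨v, hv, hvx⟩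
      refine ⟨⟨v, hvx⟩, ?_⟩
      have : h x = v := by simp only [hh_def, ← hvx, hhi]
      rw [this]
      exact mem_ball_zero_iff.1 hv
    · rintro ⟨hxS, hxr⟩
      exact ⟨h x, mem_ball_zero_iff.2 hxr, hih x hxS⟩
  have hcont : ContinuousOn h S := by
    refine e.continuousOn_symm.comp f.continuous.continuousOn fun x hx => ?_
    rw [he_def, hi.toOpenPartialHomeomorph_target]
    exact hx
  -- Step 1: Urysohn cut-offs `φ` (`= 1` on `A ρ`, `= 0` off `O 2ρ`) and `χ` (`= 1` on `A 3ρ`,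
  -- `= 0` off `O 4ρ`).
  obtain ⟨φ, hφ0, hφ1, hφ01⟩ := exists_continuous_zero_one_of_isClosed (hOo (2 * ρ)).isClosed_compl
    (hAc ρ) (disjoint_compl_left_iff_subset.2 (hAO ρ (2 * ρ) (by linarith)))
  obtain ⟨χ, hχ0, hχ1, -⟩ := exists_continuous_zero_one_of_isClosed (hOo (4 * ρ)).isClosed_compl
    (hAc (3 * ρ)) (disjoint_compl_left_iff_subset.2 (hAO (3 * ρ) (4 * ρ) (by linarith)))
  -- Step 2: the local coordinate expression `h`, cut off to a global continuous `F : K → E`,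
  -- extended to `W` and smoothed.
  set F : K → E := fun x => χ x • h x with hF_def
  have hF : Continuous F := by
    rw [continuous_iff_continuousAt]
    intro x
    by_cases hx : x ∈ S
    · exact (χ.continuous.continuousAt).smul (hcont.continuousAt (hSo.mem_nhds hx))
    · have hx' : x ∉ A (4 * ρ) := fun h' => hx (hAS _ h')
      have hev : (fun _ => (0 : E)) =ᶠ[𝓝 x] F := by
        filter_upwards [(hAc (4 * ρ)).isOpen_compl.mem_nhds hx'] with y hy
        have hy' : y ∈ (O (4 * ρ))ᶜ := fun hy' => hy (hOA _ hy')
        have : χ y = 0 := hχ0 hy'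
        simp only [hF_def, this, zero_smul]
      exact continuousAt_const.congr hev
  have huc : UniformContinuous (F ∘ π) := (CompactSpace.uniformContinuous_of_continuous hF).comp hπ
  obtain ⟨g₁, hg₁, hg₁d⟩ := huc.exists_contDiff_dist_le (ε := ρ / 4) (by positivity)
  -- Step 3: a small vector `v` which is not a value of `g₁` (`dim W < dim E`).
  have hdense : Dense (range g₁)ᶜ :=
    (hg₁.of_le (by exact_mod_cast le_top)).dense_compl_range_of_finrank_lt_finrank hWE
  obtain ⟨v, hv, hvρ⟩ := hdense.exists_mem_open isOpen_ball
    ⟨(0 : E), mem_ball_self (by positivity : (0 : ℝ) < ρ / 4)⟩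
  rw [mem_ball_zero_iff] at hvρ
  -- Step 4: the perturbed map.
  set w : K → E := fun x => h x + φ x • (g₁ (ι x) - v - h x) with hw_def
  set gin : K → M := fun x => i (w x) with hgin_def
  have hgin_cont : ContinuousOn gin S := by
    refine hi.continuous.comp_continuousOn (hcont.add (φ.continuous.continuousOn.smul ?_))
    exact (((hg₁.continuous.comp hι).continuousOn.sub continuousOn_const).sub hcont)
  have hgin_eq : ∀ x ∈ S, x ∉ O (2 * ρ) → gin x = f x := by
    intro x hxS hxO
    have : φ x = 0 := hφ0 hxO
    simp only [hgin_def, hw_def, this, zero_smul, add_zero, hih x hxS]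
  set g : K → M := (O (3 * ρ)).piecewise gin f with hg_def
  have hclos : closure (O (3 * ρ)) ⊆ A (3 * ρ) := closure_minimal (hOA _) (hAc _)
  have hg : Continuous g := by
    refine continuous_piecewise (fun a ha => ?_) (hgin_cont.mono (hclos.trans (hAS _)))
      f.continuous.continuousOn
    -- on the frontier `φ = 0`, so `gin = i ∘ h = f`
    have ha1 : a ∈ A (3 * ρ) := hclos (frontier_subset_closure ha)
    have ha2 : a ∉ O (3 * ρ) := by
      have := ha.2
      rwa [(hOo _).interior_eq] at this
    exact hgin_eq a (hAS _ ha1) fun h' => ha2 (hOO _ _ (by linarith) h')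
  refine ⟨⟨g, hg⟩, fun z hz => ?_, fun x => ?_⟩
  · -- `g = f` on `Z`, since `Z` does not meet `O (3ρ)`
    have hz' : z ∉ O (3 * ρ) := by
      rintro ⟨u, hu, huz⟩
      exact hρZ u (by rw [mem_ball_zero_iff] at hu; linarith) ⟨z, hz, huz.symm⟩
    simp only [ContinuousMap.coe_mk, hg_def, piecewise_eq_of_notMem _ _ _ hz']
  · by_cases hx : x ∈ O (3 * ρ)
    · simp only [ContinuousMap.coe_mk, hg_def, piecewise_eq_of_mem _ _ _ hx, hgin_def]
      intro heq
      have hw0 : w x = 0 := hi.injective heq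
      obtain ⟨hxS, hx3⟩ := (hO_iff _ _).1 hx
      -- `g₁ (ι x)` is `ρ/4`-close to `h x`
      have hχx : χ x = 1 := hχ1 (hOA _ hx)
      have hFx : (F ∘ π) (ι x) = h x := by
        simp only [comp_apply, hπι, hF_def, hχx, one_smul]
      have hd : ‖g₁ (ι x) - h x‖ < ρ / 4 := by
        rw [← dist_eq_norm, ← hFx]
        exact hg₁d (ι x)
      have hd' : ‖g₁ (ι x) - v - h x‖ < ρ / 2 := by
        calc ‖g₁ (ι x) - v - h x‖ = ‖(g₁ (ι x) - h x) - v‖ := by congr 1; abel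
          _ ≤ ‖g₁ (ι x) - h x‖ + ‖v‖ := norm_sub_le _ _
          _ < ρ / 4 + ρ / 4 := add_lt_add hd hvρ
          _ = ρ / 2 := by ring
      by_cases hφx : φ x = 1
      · -- then `w x = g₁ (ι x) - v`, and `v` would be a value of `g₁`
        have : w x = g₁ (ι x) - v := by
          simp only [hw_def, hφx, one_smul]
          abel
        rw [this, sub_eq_zero] at hw0
        exact hv ⟨ι x, hw0⟩
      · -- then `‖h x‖ > ρ` while the perturbation has norm `< ρ/2`
        have hxA : x ∉ A ρ := fun h' => hφx (hφ1 h')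
        rw [hA_iff] at hxA
        have hρx : ρ < ‖h x‖ := by
          by_contra hle
          exact hxA ⟨hxS, not_lt.1 hle⟩
        have hφx' : ‖φ x‖ ≤ 1 := by
          have := hφ01 x
          rw [Real.norm_eq_abs, abs_le]
          exact ⟨by linarith [this.1], this.2⟩
        have : h x = -(φ x • (g₁ (ι x) - v - h x)) := eq_neg_of_add_eq_zero_left hw0
        have : ‖h x‖ < ρ / 2 := by
          rw [this, norm_neg]
          calc ‖φ x • (g₁ (ι x) - v - h x)‖ = ‖φ x‖ * ‖g₁ (ι x) - v - h x‖ := norm_smul _ _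
            _ ≤ 1 * ‖g₁ (ι x) - v - h x‖ := by gcongr
            _ < ρ / 2 := by rw [one_mul]; exact hd'
        linarith
    · simp only [ContinuousMap.coe_mk, hg_def, piecewise_eq_of_notMem _ _ _ hx]
      intro heq
      exact hx ⟨0, mem_ball_self (by positivity), heq.symm⟩

/-- `[0,1]` is a uniform retract of `ℝ` (`projIcc`), of dimension `1`. [folklore] -/
private theorem retract_unitInterval :
    Continuous (fun x : I => (x : ℝ)) ∧ UniformContinuous (projIcc (0 : ℝ) 1 zero_le_one) ∧
      (∀ x : I, projIcc (0 : ℝ) 1 zero_le_one (x : ℝ) = x) ∧ finrank ℝ ℝ = 1 :=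
  ⟨continuous_subtype_val, (LipschitzWith.projIcc _).uniformContinuous, fun x => projIcc_val _ x,
    Module.finrank_self ℝ⟩

/-- `[0,1]²` is a uniform retract of `ℝ²`, of dimension `2`. [folklore] -/
private theorem retract_unitSquare :
    Continuous (fun x : I × I => ((x.1 : ℝ), (x.2 : ℝ))) ∧
      UniformContinuous (fun y : ℝ × ℝ =>
        (projIcc (0 : ℝ) 1 zero_le_one y.1, projIcc (0 : ℝ) 1 zero_le_one y.2)) ∧
      (∀ x : I × I, (projIcc (0 : ℝ) 1 zero_le_one (x.1 : ℝ),
        projIcc (0 : ℝ) 1 zero_le_one (x.2 : ℝ)) = x) ∧ finrank ℝ (ℝ × ℝ) = 2 := by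
  refine ⟨by fun_prop, ?_, fun x => by simp only [projIcc_val], by simp⟩
  exact ((LipschitzWith.projIcc _).uniformContinuous.comp uniformContinuous_fst).prodMk
    ((LipschitzWith.projIcc _).uniformContinuous.comp uniformContinuous_snd)

end Perturb

section Complement

variable {E : Type*} [NormedAddCommGroup E] [NormedSpace ℝ E] [FiniteDimensional ℝ E]
  {M : Type*} [TopologicalSpace M] [T2Space M] {i : E → M}

/-- If `p ∈ M` has a Euclidean neighbourhood `i : E ≅ U ∋ p = i 0` of dimension `≥ 2` in the
path connected Hausdorff space `M`, then `M ∖ {p}` is path connected: push a path joining two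
points of `M ∖ {p}` off `p` (`exists_continuousMap_eqOn_forall_ne` with `K = [0,1]`, `W = ℝ`)
(Kosinski, *Differential Manifolds* (1993), VI.1.1, "connected if `m > 1`"). [folklore] -/
theorem isPathConnected_compl_singleton_of_isOpenEmbedding [PathConnectedSpace M]
    (hi : IsOpenEmbedding i) (h2 : 1 < finrank ℝ E) : IsPathConnected ({i 0}ᶜ : Set M) := by
  obtain ⟨hι, hπ, hπι, h1⟩ := retract_unitInterval
  rw [isPathConnected_iff]
  constructor
  · haveI : Nontrivial E := Module.nontrivial_of_finrank_pos (R := ℝ) (by omega)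
    obtain ⟨v, hv⟩ := exists_ne (0 : E)
    exact ⟨i v, fun h => hv (hi.injective h)⟩
  · intro x hx y hy
    let γ : Path x y := PathConnectedSpace.somePath x y
    have hZ : IsClosed ({0, 1} : Set I) := (toFinite _).isClosed
    obtain ⟨g, hgZ, hg⟩ := exists_continuousMap_eqOn_forall_ne hι hπ hπι (h1.symm ▸ h2) hi
      γ.toContinuousMap hZ (by
        rintro z (rfl | rfl)
        · simpa using hx
        · simpa using hy)
    refine ⟨⟨g, ?_, ?_⟩, fun t => hg t⟩
    · have := hgZ (show (0 : I) ∈ ({0, 1} : Set I) by simp)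
      simpa using this
    · have := hgZ (show (1 : I) ∈ ({0, 1} : Set I) by simp)
      simpa using this

/-- **Removing a point of a manifold of dimension `≥ 3` preserves simple connectivity.** If
`p ∈ M` has a Euclidean neighbourhood `i : E ≅ U ∋ p = i 0` of dimension `≥ 3` in the simply
connected Hausdorff space `M`, then `M ∖ {p}` is simply connected: a null-homotopy in `M` of a
loop in `M ∖ {p}` is pushed off `p` by general position (`exists_continuousMap_eqOn_forall_ne`
with `K = [0,1]²`, `W = ℝ²`), keeping the boundary of the square fixed. This is the injectivity
of `π₁(M ∖ p) → π₁(M)` for `dim M ≥ 3` (Seifert–van Kampen; Kosinski, *Differential Manifolds*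
(1993), VI.2, "for `m ≥ 3`"; Hatcher, *Algebraic Topology* (2002), proof of Prop. 1.14).
[folklore] -/
theorem isSimplyConnected_compl_singleton_of_isOpenEmbedding [SimplyConnectedSpace M]
    (hi : IsOpenEmbedding i) (h3 : 2 < finrank ℝ E) : IsSimplyConnected ({i 0}ᶜ : Set M) := by
  obtain ⟨hι, hπ, hπι, h2⟩ := retract_unitSquare
  rw [isSimplyConnected_iff_exists_homotopy_refl_forall_mem]
  refine ⟨isPathConnected_compl_singleton_of_isOpenEmbedding hi (by omega), fun x p hp => ?_⟩
  obtain ⟨H⟩ := SimplyConnectedSpace.paths_homotopic p (Path.refl x)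
  -- the boundary of the square
  let Z : Set (I × I) := {z | z.1 = 0} ∪ ({z | z.1 = 1} ∪ ({z | z.2 = 0} ∪ {z | z.2 = 1}))
  have hZ : IsClosed Z :=
    (isClosed_eq continuous_fst continuous_const).union
      ((isClosed_eq continuous_fst continuous_const).union
        ((isClosed_eq continuous_snd continuous_const).union
          (isClosed_eq continuous_snd continuous_const)))
  have hx : x ≠ i 0 := by simpa using hp 0
  have hHZ : ∀ z ∈ Z, H.toContinuousMap z ≠ i 0 := by
    rintro ⟨s, t⟩ hz
    change H (s, t) ≠ i 0
    rcases hz with h | h | h | h <;> simp only [mem_setOf_eq] at h <;> subst h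
    · rw [H.apply_zero]; exact hp t
    · rw [H.apply_one]; simpa using hx
    · rw [H.eq_fst s (by simp)]; exact hp 0
    · rw [H.eq_fst s (by simp)]; exact hp 1
  obtain ⟨g, hgZ, hg⟩ := exists_continuousMap_eqOn_forall_ne hι hπ hπι (h2.symm ▸ h3) hi
    H.toContinuousMap hZ hHZ
  have hgH : ∀ z ∈ Z, g z = H z := fun z hz => hgZ hz
  refine ⟨{ toFun := g
            continuous_toFun := g.continuous
            map_zero_left := fun t => ?_
            map_one_left := fun t => ?_
            prop' := fun s t ht => ?_ }, fun st => hg st⟩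
  · rw [hgH (0, t) (Or.inl rfl)]
    exact H.apply_zero t
  · rw [hgH (1, t) (Or.inr (Or.inl rfl))]
    exact H.apply_one t
  · simp only [ContinuousMap.coe_mk]
    have hst : (s, t) ∈ Z := by
      rcases ht with h | h
      · exact Or.inr (Or.inr (Or.inl h))
      · exact Or.inr (Or.inr (Or.inr h))
    rw [hgH (s, t) hst]
    exact H.eq_fst s ht

end Complement

end Literature.AlgebraicTopology.FundamentalGroupoid
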